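import Mathlib
import Summits.ValiantsHypothesis.ValiantsHypothesis.Theorems.GeneratorObstructionsPowGenDegreeQPQuadricGenTypes

/-!
# K1 `PerGenDegreeSuperQP` (stmt-ValiantsHypothesis-11654), line `per_side_atoms`:
# the row `m = 2` — the occurrence monoid of `per_2` has exactly the four fundamental atoms

Helper file (`--supports stmt-ValiantsHypothesis-11654`).  Cross-leaf use of the quadric machinery
built for the row `m = 2` of K2 (`…PowGenDegreeQPQuadricGenTypes`: generator types of the orbit closure
of a full-rank quadric are exactly `0` and the fundamental weights `-2·𝟙_{≥ t}`, via a Borel-dense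
point with sign symmetries, principal-minor highest-weight vectors and Cholesky density).

`per_2 = X_{00} X_{11} + X_{01} X_{10}` (in its own four lexicographic letters,
`rename toLex (perPoly (Fin 2) ℂ)`) is a full-rank quadric: the antipodal pair substitution
`X_u ↦ ± X_u + X_{πu}`, `π(i,j) = (1-i,1-j)`, moves it to `X_{00}² + X_{01}² - X_{10}² - X_{11}²`
(`exists_gl_perTwo_eq_diagonal`).  Hence:

* `perTwo_genType_iff` — `γ_χ(per_2) ≠ 0 ⟺ χ = 0 ∨ χ = -2·𝟙_{≥ t}` (`t ∈ MatIdx 2`; degrees 1–4);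
* `perTwo_atom_iff` — the ATOMS of the occurrence monoid `S(per_2)` (nonzero occurring weights with no
  splitting into two nonzero occurring weights — the objects of the registered stub `stub_atomLate`)
  are exactly the four fundamental weights;
* `perTwo_atom_neg_size_le`, `not_atomLate_witness_two` — every atom of `S(per_2)` has `-|χ| ≤ 8`,
  so the row `m = 2` witnesses `stub_atomLate` for no `c ≥ 1`.

Honest label: the smallest row of K1 computed exactly (calibration; `per_2` is a quadric, `Δ(per_2) =
Sym² ℂ⁴` is spherical — nothing here bears on late atoms of `S(per_m)`, `m → ∞`, the open content
`c ≥ 2` of `stub_atomLate`).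
-/

namespace Summit.ValiantsHypothesis.ValiantsHypothesis.Theorems.GeneratorObstructions.PerGenDegreeSuperQP

open MvPolynomial
open scoped Matrix
open Literature.NumberTheory.DiophantineGeometry Literature.Computability.AlgebraicComplexity
open Summit.ValiantsHypothesis.ValiantsHypothesis.Theorems.GeneratorObstructions.PowGenDegreeQP

-- `Summit.ValiantsHypothesis.ValiantsHypothesis.…` is the tree's mandated single-conjunct layout.
set_option linter.dupNamespace false

noncomputable section

/-! ## 1. `per_2` in its four lexicographic letters -/

/-- `per_2 = X_{(0,0)} X_{(1,1)} + X_{(0,1)} X_{(1,0)}` in the letters of `MatIdx 2`. [folklore] -/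
theorem rename_toLex_perPoly_two :
    MvPolynomial.rename toLex (perPoly (Fin 2) ℂ) =
      (X (toLex ((0 : Fin 2), (0 : Fin 2))) * X (toLex ((1 : Fin 2), (1 : Fin 2))) +
        X (toLex ((0 : Fin 2), (1 : Fin 2))) * X (toLex ((1 : Fin 2), (0 : Fin 2))) :
        MvPolynomial (MatIdx 2) ℂ) := by
  have huniv : (Finset.univ : Finset (Equiv.Perm (Fin 2))) = {1, Equiv.swap 0 1} := by decide
  have hper : perPoly (Fin 2) ℂ = X (0, 0) * X (1, 1) + X (0, 1) * X (1, 0) := by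
    rw [perPoly, Matrix.permanent, huniv, Finset.sum_pair (by decide), Fin.prod_univ_two,
      Fin.prod_univ_two]
    simp [Matrix.mvPolynomialX_apply, Equiv.swap_apply_left, Equiv.swap_apply_right]
    ring
  rw [hper, map_add, map_mul, map_mul, rename_X, rename_X, rename_X, rename_X]

/-! ## 2. The antipodal pair substitution diagonalises `per_2` -/

section Pair

/-- The antipodal involution of letters `(i,j) ↦ (1-i, 1-j)` of `MatIdx 2` is an involution.
[folklore] -/
theorem antipode_invol (u : MatIdx 2) :
    (toLex (((ofLex (toLex (((ofLex u).1).rev, ((ofLex u).2).rev) : MatIdx 2)).1).rev,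
        ((ofLex (toLex (((ofLex u).1).rev, ((ofLex u).2).rev) : MatIdx 2)).2).rev) : MatIdx 2) = u := by
  simp [Fin.rev_rev]

/-- The antipodal involution has no fixed points. [folklore] -/
theorem antipode_ne (u : MatIdx 2) :
    (toLex (((ofLex u).1).rev, ((ofLex u).2).rev) : MatIdx 2) ≠ u := by
  intro h
  have h1 := congrArg (fun w : MatIdx 2 => (ofLex w).1) h
  simp only [ofLex_toLex] at h1
  have h2 := congrArg Fin.val h1
  rw [Fin.val_rev] at h2
  omega

/-- The antipodal pair substitution on a letter:
`X_u ↦ s_u X_u + X_{πu}`, `s_u = 1` if `u < πu` and `-1` otherwise. [folklore] -/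
theorem linSubst_antipodeMatrix_X (u : MatIdx 2) :
    linSubst (MatIdx 2) ℂ
        (Matrix.of fun v w : MatIdx 2 =>
          (if v = w then
              (if w < (toLex (((ofLex w).1).rev, ((ofLex w).2).rev) : MatIdx 2) then (1 : ℂ) else -1)
            else 0) +
          (if v = (toLex (((ofLex w).1).rev, ((ofLex w).2).rev) : MatIdx 2) then (1 : ℂ) else 0))
        (X u) =
      (if u < (toLex (((ofLex u).1).rev, ((ofLex u).2).rev) : MatIdx 2) then (1 : ℂ) else -1) • X u +
        X (toLex (((ofLex u).1).rev, ((ofLex u).2).rev) : MatIdx 2) := by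
  classical
  rw [linSubst_X]
  simp only [Matrix.of_apply, add_smul, Finset.sum_add_distrib, ite_smul, zero_smul,
    Finset.sum_ite_eq', Finset.mem_univ, if_true, one_smul]

/-- The square of the antipodal pair matrix is `2 · 1`. [folklore] -/
theorem antipodeMatrix_mul_self :
    (Matrix.of fun v w : MatIdx 2 =>
          (if v = w then
              (if w < (toLex (((ofLex w).1).rev, ((ofLex w).2).rev) : MatIdx 2) then (1 : ℂ) else -1)
            else 0) +
          (if v = (toLex (((ofLex w).1).rev, ((ofLex w).2).rev) : MatIdx 2) then (1 : ℂ) else 0)) *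
      (Matrix.of fun v w : MatIdx 2 =>
          (if v = w then
              (if w < (toLex (((ofLex w).1).rev, ((ofLex w).2).rev) : MatIdx 2) then (1 : ℂ) else -1)
            else 0) +
          (if v = (toLex (((ofLex w).1).rev, ((ofLex w).2).rev) : MatIdx 2) then (1 : ℂ) else 0)) =
      (2 : ℂ) • (1 : Matrix (MatIdx 2) (MatIdx 2) ℂ) := by
  classical
  ext v u
  rw [Matrix.mul_apply, Matrix.smul_apply, Matrix.one_apply]
  simp only [Matrix.of_apply, mul_add, mul_ite, mul_zero, Finset.sum_add_distrib,
    Finset.sum_ite_eq', Finset.mem_univ, if_true, antipode_invol, mul_one]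
  have hne := antipode_ne u
  have hne' : u ≠ (toLex (((ofLex u).1).rev, ((ofLex u).2).rev) : MatIdx 2) := fun h => hne h.symm
  generalize ht : (toLex (((ofLex u).1).rev, ((ofLex u).2).rev) : MatIdx 2) = t at *
  by_cases hvu : v = u
  · subst hvu
    rcases lt_or_gt_of_ne hne' with hlt | hgt
    · have h1 : ¬t < v := not_lt.mpr hlt.le
      simp [hne', hlt]
      norm_num
    · have hgt' : t < v := hgt
      have h1 : ¬v < t := not_lt.mpr hgt'.le
      simp [hne', h1]
      norm_num
  · rw [if_neg hvu]
    by_cases hvt : v = t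
    · subst hvt
      rcases lt_or_gt_of_ne hne' with hlt | hgt
      · have h1 : ¬v < u := not_lt.mpr hlt.le
        simp [hne, hlt, h1]
      · have hgt' : v < u := hgt
        have h1 : ¬u < v := not_lt.mpr hgt'.le
        simp [hne, hgt', h1]
    · simp [hvu, hvt]

/-- **`per_2` is `GL_4`-equivalent to a full-rank diagonal quadric**: with `h₀` the antipodal pair
substitution, `h₀ · per_2 = X_{00}² + X_{01}² - X_{10}² - X_{11}²`, i.e. `∑_u c_u X_u²` with
`c_u = 1` if `u < πu` and `-1` otherwise. [folklore] -/
theorem exists_gl_perTwo_eq_diagonal :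
    ∃ h₀ : GL (MatIdx 2) ℂ,
      linSubstRep (MatIdx 2) ℂ h₀ (MvPolynomial.rename toLex (perPoly (Fin 2) ℂ)) =
        ∑ u : MatIdx 2,
          (if u < (toLex (((ofLex u).1).rev, ((ofLex u).2).rev) : MatIdx 2) then (1 : ℂ) else -1) •
            (X u : MvPolynomial (MatIdx 2) ℂ) ^ 2 := by
  classical
  set A : Matrix (MatIdx 2) (MatIdx 2) ℂ := Matrix.of fun v w : MatIdx 2 =>
      (if v = w then
          (if w < (toLex (((ofLex w).1).rev, ((ofLex w).2).rev) : MatIdx 2) then (1 : ℂ) else -1)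
        else 0) +
      (if v = (toLex (((ofLex w).1).rev, ((ofLex w).2).rev) : MatIdx 2) then (1 : ℂ) else 0) with hA
  have hdet : A.det ≠ 0 := by
    intro h0
    have h := congrArg Matrix.det antipodeMatrix_mul_self
    rw [← hA, Matrix.det_mul, h0, mul_zero, Matrix.det_smul, Matrix.det_one, mul_one] at h
    exact (pow_ne_zero _ (two_ne_zero (α := ℂ))) h.symm
  refine ⟨Matrix.GeneralLinearGroup.mkOfDetNeZero A hdet, ?_⟩
  rw [linSubstRep_apply, Matrix.GeneralLinearGroup.val_mkOfDetNeZero, rename_toLex_perPoly_two,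
    map_add, map_mul, map_mul, hA, linSubst_antipodeMatrix_X, linSubst_antipodeMatrix_X,
    linSubst_antipodeMatrix_X, linSubst_antipodeMatrix_X]
  -- evaluate the involution and the signs on the four letters
  have e00 : (toLex (((ofLex (toLex ((0 : Fin 2), (0 : Fin 2)) : MatIdx 2)).1).rev,
      ((ofLex (toLex ((0 : Fin 2), (0 : Fin 2)) : MatIdx 2)).2).rev) : MatIdx 2) = toLex (1, 1) := by decide
  have e11 : (toLex (((ofLex (toLex ((1 : Fin 2), (1 : Fin 2)) : MatIdx 2)).1).rev,
      ((ofLex (toLex ((1 : Fin 2), (1 : Fin 2)) : MatIdx 2)).2).rev) : MatIdx 2) = toLex (0, 0) := by decide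
  have e01 : (toLex (((ofLex (toLex ((0 : Fin 2), (1 : Fin 2)) : MatIdx 2)).1).rev,
      ((ofLex (toLex ((0 : Fin 2), (1 : Fin 2)) : MatIdx 2)).2).rev) : MatIdx 2) = toLex (1, 0) := by decide
  have e10 : (toLex (((ofLex (toLex ((1 : Fin 2), (0 : Fin 2)) : MatIdx 2)).1).rev,
      ((ofLex (toLex ((1 : Fin 2), (0 : Fin 2)) : MatIdx 2)).2).rev) : MatIdx 2) = toLex (0, 1) := by decide
  have l1 : (toLex ((0 : Fin 2), (0 : Fin 2)) : MatIdx 2) < toLex (1, 1) := by decide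
  have l2 : ¬(toLex ((1 : Fin 2), (1 : Fin 2)) : MatIdx 2) < toLex (0, 0) := by decide
  have l3 : (toLex ((0 : Fin 2), (1 : Fin 2)) : MatIdx 2) < toLex (1, 0) := by decide
  have l4 : ¬(toLex ((1 : Fin 2), (0 : Fin 2)) : MatIdx 2) < toLex (0, 1) := by decide
  rw [e00, e11, e01, e10, if_pos l1, if_neg l2, if_pos l3, if_neg l4]
  -- expand the four-letter sum
  have hsum : (∑ u : MatIdx 2,
      (if u < (toLex (((ofLex u).1).rev, ((ofLex u).2).rev) : MatIdx 2) then (1 : ℂ) else -1) •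
        (X u : MvPolynomial (MatIdx 2) ℂ) ^ 2) =
      ∑ p : Fin 2 × Fin 2,
        (if (toLex p : MatIdx 2) < (toLex (((ofLex (toLex p : MatIdx 2)).1).rev,
            ((ofLex (toLex p : MatIdx 2)).2).rev) : MatIdx 2) then (1 : ℂ) else -1) •
          (X (toLex p : MatIdx 2) : MvPolynomial (MatIdx 2) ℂ) ^ 2 :=
    (Equiv.sum_comp toLex _).symm
  rw [hsum, Fintype.sum_prod_type, Fin.sum_univ_two, Fin.sum_univ_two, Fin.sum_univ_two, e00, e11,
    e01, e10, if_pos l1, if_neg l2, if_pos l3, if_neg l4]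
  simp only [one_smul, neg_smul]
  ring

end Pair

/-! ## 3. The occurrence monoid of `per_2` -/

/-- **Generator types of `A(Δ_2(per_2))` are exactly `0` and the four fundamental weights
`-2·𝟙_{≥ t}`**, `t ∈ MatIdx 2` (degrees `1, 2, 3, 4`): `per_2` is a full-rank quadric in its four
letters, so `genType_iff_fundamental_of_linSubstRep_eq_diagonal` applies. [folklore] -/
theorem perTwo_genType_iff (χ : Weight (MatIdx 2)) :
    Module.finrank ℂ
      (↥(highestWeightSpace (orbitCoordRep (MvPolynomial.rename toLex (perPoly (Fin 2) ℂ)) 2) χ) ⧸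
        Submodule.comap
          (highestWeightSpace (orbitCoordRep (MvPolynomial.rename toLex (perPoly (Fin 2) ℂ)) 2) χ).subtype
          (⨆ p : Weight (MatIdx 2) × Weight (MatIdx 2), ⨆ (_ : p.1 + p.2 = χ ∧ p.1 ≠ 0 ∧ p.2 ≠ 0),
            highestWeightSpace (orbitCoordRep (MvPolynomial.rename toLex (perPoly (Fin 2) ℂ)) 2) p.1 *
              highestWeightSpace (orbitCoordRep (MvPolynomial.rename toLex (perPoly (Fin 2) ℂ)) 2) p.2)) ≠
      0 ↔ χ = 0 ∨ ∃ t : MatIdx 2, χ = fun v => if t ≤ v then (-2 : ℤ) else 0 := by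
  obtain ⟨h₀, hh₀⟩ := exists_gl_perTwo_eq_diagonal
  exact genType_iff_fundamental_of_linSubstRep_eq_diagonal _ h₀ _
    (fun u => by split_ifs <;> norm_num) hh₀ χ

/-- **Atoms of the occurrence monoid `S(per_2)` are exactly the four fundamental weights**
(plus, degenerately, `0` if one allows it — excluded here by `χ ≠ 0`): an occurring nonzero weight
of `ℂ[Δ_2(per_2)]` with no splitting into two nonzero occurring weights is `-2·𝟙_{≥ t}`, and
conversely (atoms ⟺ generator types at a Borel-dense point). [folklore] -/
theorem perTwo_atom_iff (χ : Weight (MatIdx 2)) (hχ : χ ≠ 0) :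
    (highestWeightSpace (orbitCoordRep (MvPolynomial.rename toLex (perPoly (Fin 2) ℂ)) 2) χ ≠ ⊥ ∧
      ∀ χ₁ χ₂ : Weight (MatIdx 2), χ₁ + χ₂ = χ → χ₁ ≠ 0 → χ₂ ≠ 0 →
        highestWeightSpace (orbitCoordRep (MvPolynomial.rename toLex (perPoly (Fin 2) ℂ)) 2) χ₁ = ⊥ ∨
          highestWeightSpace (orbitCoordRep (MvPolynomial.rename toLex (perPoly (Fin 2) ℂ)) 2) χ₂ = ⊥) ↔
      ∃ t : MatIdx 2, χ = fun v => if t ≤ v then (-2 : ℤ) else 0 := by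
  classical
  haveI : Infinite ℂ := CharZero.infinite ℂ
  obtain ⟨h₀, hh₀⟩ := exists_gl_perTwo_eq_diagonal
  have hc : ∀ u : MatIdx 2,
      (if u < (toLex (((ofLex u).1).rev, ((ofLex u).2).rev) : MatIdx 2) then (1 : ℂ) else -1) ≠ 0 :=
    fun u => by split_ifs <;> norm_num
  constructor
  · rintro ⟨hocc, hatom⟩
    have hγ := finrank_quotient_ne_zero_of_atom _ two_ne_zero hocc hatom
    rcases (genType_iff_fundamental_of_linSubstRep_eq_diagonal _ h₀ _ hc hh₀ χ).mp hγ with h | h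
    · exact absurd h hχ
    · exact h
  · rintro ⟨t, rfl⟩
    have hγ := (genType_iff_fundamental_of_linSubstRep_eq_diagonal _ h₀ _ hc hh₀ _).mpr
      (Or.inr ⟨t, rfl⟩)
    exact ⟨hfund_of_linSubstRep_eq_diagonal _ h₀ _ hc hh₀ t,
      atom_of_genType_of_dense (hdense_of_linSubstRep_eq_diagonal _ h₀ _ hc hh₀) hγ⟩

/-- **The row `m = 2` of K1 carries no late atom**: every atom `χ` of `S(per_2)` has
`-|χ| ≤ 8 = 2 · 4`, so `m = 2` witnesses `stub_atomLate` for NO `c ≥ 1`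
(`2 · 2^((log₂ 2 + c)^c) ≥ 8`); witnesses of the stub (if any) live at `m ≥ 3`. [folklore] -/
theorem perTwo_atom_neg_size_le (χ : Weight (MatIdx 2))
    (hocc : highestWeightSpace (orbitCoordRep (MvPolynomial.rename toLex (perPoly (Fin 2) ℂ)) 2) χ ≠ ⊥)
    (hatom : ∀ χ₁ χ₂ : Weight (MatIdx 2), χ₁ + χ₂ = χ → χ₁ ≠ 0 → χ₂ ≠ 0 →
      highestWeightSpace (orbitCoordRep (MvPolynomial.rename toLex (perPoly (Fin 2) ℂ)) 2) χ₁ = ⊥ ∨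
        highestWeightSpace (orbitCoordRep (MvPolynomial.rename toLex (perPoly (Fin 2) ℂ)) 2) χ₂ = ⊥) :
    -(Weight.size χ) ≤ 8 := by
  classical
  haveI : Infinite ℂ := CharZero.infinite ℂ
  obtain ⟨h₀, hh₀⟩ := exists_gl_perTwo_eq_diagonal
  have hc : ∀ u : MatIdx 2,
      (if u < (toLex (((ofLex u).1).rev, ((ofLex u).2).rev) : MatIdx 2) then (1 : ℂ) else -1) ≠ 0 :=
    fun u => by split_ifs <;> norm_num
  have hγ := finrank_quotient_ne_zero_of_atom _ two_ne_zero hocc hatom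
  have h := neg_size_le_of_genType_of_sign_of_fund
    (hdense_of_linSubstRep_eq_diagonal _ h₀ _ hc hh₀)
    (fun u => hsign_of_linSubstRep_eq_diagonal _ h₀ _ hh₀ u)
    (hfund_of_linSubstRep_eq_diagonal _ h₀ _ hc hh₀) hγ
  have hcard : Fintype.card (MatIdx 2) = 4 := by
    rw [Fintype.card_lex, Fintype.card_prod, Fintype.card_fin]
  rw [hcard] at h
  exact_mod_cast h

/-- **No `stub_atomLate` witness at `m = 2` for `c ≥ 1`.** [folklore] -/
theorem not_atomLate_witness_two {c : ℕ} (hc : 1 ≤ c) (χ : Weight (MatIdx 2))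
    (hocc : highestWeightSpace (orbitCoordRep (MvPolynomial.rename toLex (perPoly (Fin 2) ℂ)) 2) χ ≠ ⊥)
    (hatom : ∀ χ₁ χ₂ : Weight (MatIdx 2), χ₁ + χ₂ = χ → χ₁ ≠ 0 → χ₂ ≠ 0 →
      highestWeightSpace (orbitCoordRep (MvPolynomial.rename toLex (perPoly (Fin 2) ℂ)) 2) χ₁ = ⊥ ∨
        highestWeightSpace (orbitCoordRep (MvPolynomial.rename toLex (perPoly (Fin 2) ℂ)) 2) χ₂ = ⊥) :
    ¬((2 : ℕ) : ℤ) * 2 ^ ((Nat.log 2 2 + c) ^ c) < -(Weight.size χ) := by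
  have h8 := perTwo_atom_neg_size_le χ hocc hatom
  have hlog : Nat.log 2 2 = 1 := by norm_num
  rw [hlog, not_lt]
  have h1 : 2 ≤ (1 + c) ^ c := by
    calc 2 ≤ 1 + c := by omega
      _ ≤ (1 + c) ^ c := Nat.le_self_pow (by omega) _
  have h2 : (4 : ℤ) ≤ 2 ^ ((1 + c) ^ c) := by
    have : (2 : ℤ) ^ 2 ≤ 2 ^ ((1 + c) ^ c) := pow_le_pow_right₀ (by norm_num) h1
    norm_num at this
    exact this
  push_cast
  linarith

end

end Summit.ValiantsHypothesis.ValiantsHypothesis.Theorems.GeneratorObstructions.PerGenDegreeSuperQP
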